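import Summits.BirchSwinnertonDyer.Rank1Residual.Supersingular.SignedRankOneLinkBKO
import Summits.BirchSwinnertonDyer.Rank1Residual.Supersingular.SharpFlatConverseReal
import Literature.NumberTheory.EllipticCurves.BSDSelmerPConverseRamifiedProofs
import HarnessLib

/-!
# X8 without Wuthrich's Lemma 20: `3`-adic tower surjectivity from surj(3) + (ram), and the
# ♯/♭ per-pair readings with the binder `hL20` REPLACED by the census bit `Ram W 3`
# (cell `b2b-bsdres`, supersingular family, prover B = unit `b2b-bsdres-additive-p3`, gen 16)

HONEST FRAMING (run/shared/lean/b2b/bsd-rank1-residual/, verbatim in every file): the goal of the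
cell is to DELETE the COMBINATION-SHAPED residual classes of the Birch–Swinnerton-Dyer formula for
ALL analytic-rank `≤ 1` elliptic curves over `ℚ` — "full BSD formula for every rank `≤ 1` curve in
class `C`" assembled STRICTLY from published theorems — so that the rank-`≤ 1` remainder becomes
exactly the CONSTRUCTION-SHAPED classes, which are TYPED (missing-input `Prop`s), NOT attempted.
This is not "finishing BSD". THEOREMS ONLY (no definition, no named fact, nothing about any
particular curve asserted); X8 stays CONSTRUCTION-SHAPED; nothing is booked.

## What this file does (a binder swap, in the sense of lit-kato GEN 7)

The X8 per-pair readings of `Supersingular/SignedSqueeze.lean`, `SqueezeCertificates.lean`,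
`SignedRankOneLinkBKO.lean` and `SharpFlatConverseReal.lean` take the named fact
`Wuthrich2014.lemma20_surjective_threeAdic_of_semistable` (registry A9: at a prime `3` of good or
multiplicative reduction, `ρ̄_{E,3}` onto ⟹ every `ρ̄_{E,3ⁿ}` onto; printed proof via Elkies'
parametrisation) only to feed the `3`-adic TOWER `∀ n, ρ̄_{E,3ⁿ}` onto into the displayed integral
Kato divisibility `hKato` (Sprung 2012 Thm. 7.16 with `n = 0`). lit-kato GEN 7 PROVED A9 at a good
ORDINARY or MULTIPLICATIVE `3` and recorded "good supersingular 3 = the fact's residual scope"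
(`Supersingular/SignedSqueeze*` sites NOT swappable). This file swaps them anyway on the sub-locus
where the tree ALREADY proves the tower by a different published route: Serre's transvection
lifting (all `p`) from ONE multiplicative prime `ℓ ≠ p` with `p ∤ v_ℓ(Δ_min)` — the cell's predicate
`Ram W p` (hypothesis (ram) of Skinner–Urban / BSTW Part II) — namely the Literature theorem
`hasSurjectiveModNGaloisRep_pow_of_hasMultiplicativeReductionAtPrime` ("at `p = 3` it replaces
Wuthrich 2014, Lemma 20"):

* `towerSurj_of_surj_of_ram`: `Surj W p → Ram W p → ∀ n, ρ̄_{E,pⁿ}` onto (any prime `p`);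
  `ClassX8.towerSurj_of_semistable_of_ram` (surj(3) automatic for semistable X8, Serre Prop. 21 i)).
* `_of_tower` primitives (hypothesis = the tower itself, so that ANY source — A9, (ram), or a
  per-pair mod-9 certificate — can be plugged) and `_of_ram` twins of: the rank-one λ-squeeze
  `X8.charIdealEq_of_lam_eq_one_…`, the certificate forms `X8.span_eq_span_sharp/flat_of_mazurTate_…`,
  the BKO-link readings `X8.bsdp_of_mazurTate_sharp/flat_of_bkoLink_…`, and the rank-zero exact form
  `X8.bsdp_iff_span_eq_span_chromaticL_…` — each a one-line re-assembly of the generic theorem the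
  original used, with `hL20 W (Or.inl hgood) hs` replaced by the tower.

So on X8 ∧ surj(3) ∧ (ram@3) — a DECIDABLE census bit: some multiplicative `ℓ` with
`3 ∤ ord_ℓ(Δ_min)`; for X8 ∧ sst it reads "some Tamagawa exponent `ord_ℓ Δ` prime to `3`" — the A9
binder of the per-pair ♯/♭ chain is GONE (one unproved published input fewer; the displayed inputs
left are `hKato`/(K•)/`hBKO` on the absent Selmer side). Pairs with `3 ∣ ord_ℓ(Δ_min)` at EVERY
multiplicative `ℓ` (and all of X8 ∧ ¬sst without a multiplicative prime) keep A9.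

References: [Wuthrich2014] Lemma 20 (p. 399); [SerreAbelianLadic1968] IV §3.4, A.1.2;
[SilvermanATAEC1994] V.6 Prop. 6.1, Ex. 5.13(b); [BurungaleSkinnerTianWan2024] Part II (sur), (ram);
[Sprung2012] Thm. 7.16, Prop. 7.19, MC 7.21; [BurungaleKobayashiOta2023] App. A Cor. A.5.
-/

set_option autoImplicit false

noncomputable section

open scoped Classical MatrixGroups ModularForm

open CongruenceSubgroup WeierstrassCurve Literature.NumberTheory.EllipticCurves
  Literature.NumberTheory.EllipticCurves.ModularForms
  Literature.NumberTheory.EllipticCurves.Rank1Residual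
  Literature.NumberTheory.EllipticCurves.Rank1Residual.Typed
  Literature.NumberTheory.EllipticCurves.Sprung2017
  Summit.BirchSwinnertonDyer.Rank1Residual.X1.MuLambda

namespace Summit.BirchSwinnertonDyer.Rank1Residual.Supersingular

/-! ### The tower from surj(p) + (ram) -/

section Tower

variable (W : WeierstrassCurve ℚ) [W.IsElliptic] [W.IsGloballyMinimal] (p : ℕ) [Fact p.Prime]

/-- **surj(p) ∧ (ram) ⟹ every `ρ̄_{E,pⁿ}` is onto** (any prime `p`): the cell-vocabulary form of
`hasSurjectiveModNGaloisRep_pow_of_hasMultiplicativeReductionAtPrime` (inertia at a multiplicative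
`ℓ ≠ p` with `p ∤ v_ℓ(Δ_min)` supplies a unipotent element moving a `p`-torsion point; Serre's
transvection lifting). At `p = 3` this is Wuthrich's Lemma 20 conclusion WITHOUT Lemma 20.
[cite: SerreAbelianLadic1968, Ch. IV §3.4 and A.1.2] [cite: SilvermanATAEC1994, Exercise 5.13(b) (PDF p. 416)] -/
theorem towerSurj_of_surj_of_ram (hs : Surj W p) (hram : Ram W p) (n : ℕ) :
    W.HasSurjectiveModNGaloisRep (p ^ n : ℕ) :=
  hasSurjectiveModNGaloisRep_pow_of_hasMultiplicativeReductionAtPrime W p hs hram n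

/-- **X8 ∧ surj(3) ∧ (ram@3) ⟹ the `3`-adic tower.** [cite: SerreAbelianLadic1968, Ch. IV §3.4 and A.1.2] -/
theorem ClassX8.towerSurj_of_surj_of_ram (hX : ClassX8 W p) (hs : Surj W p) (hram : Ram W p)
    (n : ℕ) : W.HasSurjectiveModNGaloisRep (p ^ n : ℕ) := by
  have _ := hX.1
  exact Summit.BirchSwinnertonDyer.Rank1Residual.Supersingular.towerSurj_of_surj_of_ram W p hs hram n

/-- **X8 ∧ sst ∧ (ram@3) ⟹ the `3`-adic tower**, surj(3) being automatic for semistable X8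
(`ClassX8.surj_of_semistable`, Serre 1972 §5.4 Prop. 21 i)). [cite: Serre1972, §5.4 Prop. 21 i)]
[cite: SerreAbelianLadic1968, Ch. IV §3.4 and A.1.2] -/
theorem ClassX8.towerSurj_of_semistable_of_ram (hX : ClassX8 W p) (hsst : Semistable W)
    (hram : Ram W p) (n : ℕ) : W.HasSurjectiveModNGaloisRep (p ^ n : ℕ) := by
  have hp3 : p = 3 := hX.1
  subst hp3
  exact Summit.BirchSwinnertonDyer.Rank1Residual.Supersingular.towerSurj_of_surj_of_ram W 3
    (ClassX8.surj_of_semistable W 3 hX hsst) hram n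

end Tower

/-! ### Rank one: the λ-squeeze and the certificate forms, tower as hypothesis / from (ram) -/

section RankOne

variable (W : WeierstrassCurve ℚ) [W.IsElliptic] [W.IsGloballyMinimal] (p : ℕ) [Fact p.Prime]

/-- **X8 ∧ `r_an = 1`, tower given: the ♯/♭ main conjecture AT THE PAIR from the λ-certificate**
(`X8.charIdealEq_of_lam_eq_one_of_analyticRank_eq_one` with the A9 binder replaced by the tower
itself). [cite: Sprung2012, Thm. 7.16, Prop. 7.19, Main Conj. 7.21 (pp. 1504–1505)] [cite: Sprung2024, Lemma 5.6 (p. 41)] -/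
theorem X8.charIdealEq_of_lam_eq_one_of_analyticRank_eq_one_of_tower
    (hGZK : rank_eq_analyticRank_of_analyticRank_le_one)
    (hX : ClassX8 W p) (htower : ∀ n : ℕ, W.HasSurjectiveModNGaloisRep (p ^ n : ℕ))
    (h1 : W.analyticRank = 1) (D : SignedDatum W p) (hC : D.OrderOfVanishing)
    (hKato : (∀ n : ℕ, W.HasSurjectiveModNGaloisRep (p ^ n : ℕ)) → D.UpperDivisibility)
    (hμ : mu D.L = 0) (hlam : lam D.L = 1) : D.CharIdealEq := by
  have _ := hX.1
  exact D.charIdealEq_of_lam_eq_one hGZK h1 hC (hKato htower) hμ hlam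

/-- **X8 ∧ `r_an = 1` ∧ surj(3) ∧ (ram@3): the ♯/♭ main conjecture AT THE PAIR from the
λ-certificate, NO Lemma-20 binder.** [cite: Sprung2012, Thm. 7.16, Prop. 7.19, Main Conj. 7.21 (pp. 1504–1505)]
[cite: Sprung2024, Lemma 5.6 (p. 41)] [cite: SerreAbelianLadic1968, Ch. IV §3.4 and A.1.2] -/
theorem X8.charIdealEq_of_lam_eq_one_of_analyticRank_eq_one_of_ram
    (hGZK : rank_eq_analyticRank_of_analyticRank_le_one)
    (hX : ClassX8 W p) (hs : Surj W p) (hram : Ram W p) (h1 : W.analyticRank = 1)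
    (D : SignedDatum W p) (hC : D.OrderOfVanishing)
    (hKato : (∀ n : ℕ, W.HasSurjectiveModNGaloisRep (p ^ n : ℕ)) → D.UpperDivisibility)
    (hμ : mu D.L = 0) (hlam : lam D.L = 1) : D.CharIdealEq :=
  X8.charIdealEq_of_lam_eq_one_of_analyticRank_eq_one_of_tower W p hGZK hX
    (ClassX8.towerSurj_of_surj_of_ram W p hX hs hram) h1 D hC hKato hμ hlam

/-- **X8 ∧ `r_an = 1`, colour ♯, tower given: `(ξ) = (L♯_3(E))` from ONE odd-level Mazur–Tate
certificate** (`λ(Θ) = deg ω_n^+ + 1 < 3ⁿ`). [cite: Sprung2012, Thm. 7.16 and Main Conj. 7.21 (pp. 1504–1505)]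
[cite: Sprung2017, §3, Cor. 3.6 and Thm. 1.12] -/
theorem X8.span_eq_span_sharp_of_mazurTate_of_analyticRank_eq_one_of_tower
    (hGZK : rank_eq_analyticRank_of_analyticRank_le_one)
    (hX : ClassX8 W p) (htower : ∀ m : ℕ, W.HasSurjectiveModNGaloisRep (p ^ m : ℕ))
    (h1 : W.analyticRank = 1)
    {N : ℕ} [NeZero N] {f : CuspForm (Gamma0 N) 2} (hf : IsNewformOf W f)
    {Lsharp Lflat : IwasawaAlgebra p} (hSP : IsSprungPair f p (W.frobeniusTrace p) Lsharp Lflat)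
    (ξ : IwasawaAlgebra p) (hC : (PowerSeries.X : IwasawaAlgebra p) ^ W.mordellWeilRank ∣ ξ)
    (hKato : (∀ m : ℕ, W.HasSurjectiveModNGaloisRep (p ^ m : ℕ)) → ξ ∣ Lsharp)
    {n : ℕ} (hn : Odd n) {Θ : IwasawaAlgebra p}
    (hΘ : iwasawaToPowerSeries p Θ =
      ((mazurTateElement f p n).map (algebraMap ℚ ℚ_[p]) : PowerSeries ℚ_[p]))
    (hΘ0 : Θ ≠ 0) (hμ : mu Θ = 0) (hlam : lam Θ = (cyclotomicOmegaPlus p n).natDegree + 1)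
    (hlt : lam Θ < p ^ n) :
    Ideal.span ({ξ} : Set (IwasawaAlgebra p)) = Ideal.span {Lsharp} := by
  have hX' := hX
  obtain ⟨hp3, ⟨hgood, hap⟩, -⟩ := hX'
  subst hp3
  obtain ⟨hμL, hlamL⟩ :=
    lam_sharp_eq_of_mazurTate (by decide) hf hgood hap hSP hn hΘ hΘ0 hμ hlam hlt
  exact X8.charIdealEq_of_lam_eq_one_of_analyticRank_eq_one_of_tower W 3 hGZK hX htower h1
    ⟨ξ, Lsharp, 0⟩ hC hKato hμL hlamL

/-- **X8 ∧ `r_an = 1`, colour ♭, tower given: `(ξ) = (L♭_3(E))` from ONE even-level Mazur–Tate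
certificate** (`λ(Θ) = deg ω_n^- + 1 < 3ⁿ`). [cite: Sprung2012, Thm. 7.16 and Main Conj. 7.21 (pp. 1504–1505)]
[cite: Sprung2017, §3, Cor. 3.6 and Thm. 1.12] -/
theorem X8.span_eq_span_flat_of_mazurTate_of_analyticRank_eq_one_of_tower
    (hGZK : rank_eq_analyticRank_of_analyticRank_le_one)
    (hX : ClassX8 W p) (htower : ∀ m : ℕ, W.HasSurjectiveModNGaloisRep (p ^ m : ℕ))
    (h1 : W.analyticRank = 1)
    {N : ℕ} [NeZero N] {f : CuspForm (Gamma0 N) 2} (hf : IsNewformOf W f)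
    {Lsharp Lflat : IwasawaAlgebra p} (hSP : IsSprungPair f p (W.frobeniusTrace p) Lsharp Lflat)
    (ξ : IwasawaAlgebra p) (hC : (PowerSeries.X : IwasawaAlgebra p) ^ W.mordellWeilRank ∣ ξ)
    (hKato : (∀ m : ℕ, W.HasSurjectiveModNGaloisRep (p ^ m : ℕ)) → ξ ∣ Lflat)
    {n : ℕ} (hn : Even n) {Θ : IwasawaAlgebra p}
    (hΘ : iwasawaToPowerSeries p Θ =
      ((mazurTateElement f p n).map (algebraMap ℚ ℚ_[p]) : PowerSeries ℚ_[p]))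
    (hΘ0 : Θ ≠ 0) (hμ : mu Θ = 0) (hlam : lam Θ = (cyclotomicOmegaMinus p n).natDegree + 1)
    (hlt : lam Θ < p ^ n) :
    Ideal.span ({ξ} : Set (IwasawaAlgebra p)) = Ideal.span {Lflat} := by
  have hX' := hX
  obtain ⟨hp3, ⟨hgood, hap⟩, -⟩ := hX'
  subst hp3
  obtain ⟨hμL, hlamL⟩ :=
    lam_flat_eq_of_mazurTate (by decide) hf hgood hap hSP hn hΘ hΘ0 hμ hlam hlt
  exact X8.charIdealEq_of_lam_eq_one_of_analyticRank_eq_one_of_tower W 3 hGZK hX htower h1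
    ⟨ξ, Lflat, 0⟩ hC hKato hμL hlamL

/-- **X8 ∧ `r_an = 1`, colour ♯, tower given: `BSD(E,3)` from ONE odd-level certificate and the
displayed link `hBKO`** (BKO Cor. A.5 ∘ Sprung 2012 p. 1505). PER PAIR.
[cite: BurungaleKobayashiOta2023, App. A Cor. A.5] [cite: Sprung2012, Thm. 7.16, Prop. 7.19 and Main Conj. 7.21 (pp. 1504–1505)]
[cite: Miller2011LMS, §1 and Def. 1.1] -/
theorem X8.bsdp_of_mazurTate_sharp_of_bkoLink_of_analyticRank_eq_one_of_tower
    (hGZK : rank_eq_analyticRank_of_analyticRank_le_one)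
    (hX : ClassX8 W p) (htower : ∀ m : ℕ, W.HasSurjectiveModNGaloisRep (p ^ m : ℕ))
    (h1 : W.analyticRank = 1)
    {N : ℕ} [NeZero N] {f : CuspForm (Gamma0 N) 2} (hf : IsNewformOf W f)
    {Lsharp Lflat : IwasawaAlgebra p} (hSP : IsSprungPair f p (W.frobeniusTrace p) Lsharp Lflat)
    (ξ : IwasawaAlgebra p) (hC : (PowerSeries.X : IwasawaAlgebra p) ^ W.mordellWeilRank ∣ ξ)
    (hKato : (∀ m : ℕ, W.HasSurjectiveModNGaloisRep (p ^ m : ℕ)) → ξ ∣ Lsharp)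
    {n : ℕ} (hn : Odd n) {Θ : IwasawaAlgebra p}
    (hΘ : iwasawaToPowerSeries p Θ =
      ((mazurTateElement f p n).map (algebraMap ℚ ℚ_[p]) : PowerSeries ℚ_[p]))
    (hΘ0 : Θ ≠ 0) (hμ : mu Θ = 0) (hlam : lam Θ = (cyclotomicOmegaPlus p n).natDegree + 1)
    (hlt : lam Θ < p ^ n)
    (hBKO : Ideal.span ({ξ} : Set (IwasawaAlgebra p)) = Ideal.span {Lsharp} → MissingPPartAt W p) :
    BSDp W p :=
  bsdp_of_missingPPartAt W p hGZK h1.le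
    (hBKO (X8.span_eq_span_sharp_of_mazurTate_of_analyticRank_eq_one_of_tower W p hGZK hX htower h1
      hf hSP ξ hC hKato hn hΘ hΘ0 hμ hlam hlt))

/-- **X8 ∧ `r_an = 1`, colour ♭, tower given: `BSD(E,3)` from ONE even-level certificate and
`hBKO`.** PER PAIR. [cite: BurungaleKobayashiOta2023, App. A Cor. A.5]
[cite: Sprung2012, Thm. 7.16, Prop. 7.19 and Main Conj. 7.21 (pp. 1504–1505)] [cite: Miller2011LMS, §1 and Def. 1.1] -/
theorem X8.bsdp_of_mazurTate_flat_of_bkoLink_of_analyticRank_eq_one_of_tower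
    (hGZK : rank_eq_analyticRank_of_analyticRank_le_one)
    (hX : ClassX8 W p) (htower : ∀ m : ℕ, W.HasSurjectiveModNGaloisRep (p ^ m : ℕ))
    (h1 : W.analyticRank = 1)
    {N : ℕ} [NeZero N] {f : CuspForm (Gamma0 N) 2} (hf : IsNewformOf W f)
    {Lsharp Lflat : IwasawaAlgebra p} (hSP : IsSprungPair f p (W.frobeniusTrace p) Lsharp Lflat)
    (ξ : IwasawaAlgebra p) (hC : (PowerSeries.X : IwasawaAlgebra p) ^ W.mordellWeilRank ∣ ξ)
    (hKato : (∀ m : ℕ, W.HasSurjectiveModNGaloisRep (p ^ m : ℕ)) → ξ ∣ Lflat)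
    {n : ℕ} (hn : Even n) {Θ : IwasawaAlgebra p}
    (hΘ : iwasawaToPowerSeries p Θ =
      ((mazurTateElement f p n).map (algebraMap ℚ ℚ_[p]) : PowerSeries ℚ_[p]))
    (hΘ0 : Θ ≠ 0) (hμ : mu Θ = 0) (hlam : lam Θ = (cyclotomicOmegaMinus p n).natDegree + 1)
    (hlt : lam Θ < p ^ n)
    (hBKO : Ideal.span ({ξ} : Set (IwasawaAlgebra p)) = Ideal.span {Lflat} → MissingPPartAt W p) :
    BSDp W p :=
  bsdp_of_missingPPartAt W p hGZK h1.le
    (hBKO (X8.span_eq_span_flat_of_mazurTate_of_analyticRank_eq_one_of_tower W p hGZK hX htower h1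
      hf hSP ξ hC hKato hn hΘ hΘ0 hμ hlam hlt))

/-- **X8 ∧ `r_an = 1` ∧ surj(3) ∧ (ram@3), colour ♯: `BSD(E,3)` from ONE odd-level Mazur–Tate
certificate and `hBKO` — NO Lemma-20 binder.** The displayed non-published inputs left are `hKato`
(Sprung 2012 Thm. 7.16 on the absent `Sel♯`) and `hBKO` (BKO Cor. A.5). PER PAIR.
[cite: BurungaleKobayashiOta2023, App. A Cor. A.5] [cite: Sprung2012, Thm. 7.16, Prop. 7.19 and Main Conj. 7.21 (pp. 1504–1505)]
[cite: SerreAbelianLadic1968, Ch. IV §3.4 and A.1.2] [cite: Miller2011LMS, §1 and Def. 1.1] -/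
theorem X8.bsdp_of_mazurTate_sharp_of_bkoLink_of_analyticRank_eq_one_of_ram
    (hGZK : rank_eq_analyticRank_of_analyticRank_le_one)
    (hX : ClassX8 W p) (hs : Surj W p) (hram : Ram W p) (h1 : W.analyticRank = 1)
    {N : ℕ} [NeZero N] {f : CuspForm (Gamma0 N) 2} (hf : IsNewformOf W f)
    {Lsharp Lflat : IwasawaAlgebra p} (hSP : IsSprungPair f p (W.frobeniusTrace p) Lsharp Lflat)
    (ξ : IwasawaAlgebra p) (hC : (PowerSeries.X : IwasawaAlgebra p) ^ W.mordellWeilRank ∣ ξ)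
    (hKato : (∀ m : ℕ, W.HasSurjectiveModNGaloisRep (p ^ m : ℕ)) → ξ ∣ Lsharp)
    {n : ℕ} (hn : Odd n) {Θ : IwasawaAlgebra p}
    (hΘ : iwasawaToPowerSeries p Θ =
      ((mazurTateElement f p n).map (algebraMap ℚ ℚ_[p]) : PowerSeries ℚ_[p]))
    (hΘ0 : Θ ≠ 0) (hμ : mu Θ = 0) (hlam : lam Θ = (cyclotomicOmegaPlus p n).natDegree + 1)
    (hlt : lam Θ < p ^ n)
    (hBKO : Ideal.span ({ξ} : Set (IwasawaAlgebra p)) = Ideal.span {Lsharp} → MissingPPartAt W p) :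
    BSDp W p :=
  X8.bsdp_of_mazurTate_sharp_of_bkoLink_of_analyticRank_eq_one_of_tower W p hGZK hX
    (ClassX8.towerSurj_of_surj_of_ram W p hX hs hram) h1 hf hSP ξ hC hKato hn hΘ hΘ0 hμ hlam hlt hBKO

/-- **X8 ∧ `r_an = 1` ∧ surj(3) ∧ (ram@3), colour ♭: `BSD(E,3)` from ONE even-level certificate and
`hBKO` — NO Lemma-20 binder.** PER PAIR. [cite: BurungaleKobayashiOta2023, App. A Cor. A.5]
[cite: Sprung2012, Thm. 7.16, Prop. 7.19 and Main Conj. 7.21 (pp. 1504–1505)] [cite: SerreAbelianLadic1968, Ch. IV §3.4 and A.1.2] -/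
theorem X8.bsdp_of_mazurTate_flat_of_bkoLink_of_analyticRank_eq_one_of_ram
    (hGZK : rank_eq_analyticRank_of_analyticRank_le_one)
    (hX : ClassX8 W p) (hs : Surj W p) (hram : Ram W p) (h1 : W.analyticRank = 1)
    {N : ℕ} [NeZero N] {f : CuspForm (Gamma0 N) 2} (hf : IsNewformOf W f)
    {Lsharp Lflat : IwasawaAlgebra p} (hSP : IsSprungPair f p (W.frobeniusTrace p) Lsharp Lflat)
    (ξ : IwasawaAlgebra p) (hC : (PowerSeries.X : IwasawaAlgebra p) ^ W.mordellWeilRank ∣ ξ)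
    (hKato : (∀ m : ℕ, W.HasSurjectiveModNGaloisRep (p ^ m : ℕ)) → ξ ∣ Lflat)
    {n : ℕ} (hn : Even n) {Θ : IwasawaAlgebra p}
    (hΘ : iwasawaToPowerSeries p Θ =
      ((mazurTateElement f p n).map (algebraMap ℚ ℚ_[p]) : PowerSeries ℚ_[p]))
    (hΘ0 : Θ ≠ 0) (hμ : mu Θ = 0) (hlam : lam Θ = (cyclotomicOmegaMinus p n).natDegree + 1)
    (hlt : lam Θ < p ^ n)
    (hBKO : Ideal.span ({ξ} : Set (IwasawaAlgebra p)) = Ideal.span {Lflat} → MissingPPartAt W p) :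
    BSDp W p :=
  X8.bsdp_of_mazurTate_flat_of_bkoLink_of_analyticRank_eq_one_of_tower W p hGZK hX
    (ClassX8.towerSurj_of_surj_of_ram W p hX hs hram) h1 hf hSP ξ hC hKato hn hΘ hΘ0 hμ hlam hlt hBKO

end RankOne

/-! ### Rank zero: the exact form `BSD(E,3) ⟺ (ξ•) = (L•)`, tower as hypothesis / from (ram) -/

section RankZero

variable (W : WeierstrassCurve ℚ) [W.IsElliptic] [W.IsGloballyMinimal] (p : ℕ) [Fact p.Prime]

/-- **X8 ∧ `r_an = 0`, tower given: `BSD(E,3) ⟺` Sprung's Main Conj. 7.21 at the pair for the REAL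
`L^•_3(E)`, EITHER colour** (`X8.bsdp_iff_span_eq_span_chromaticL_of_analyticRank_eq_zero` with the
A9 binder replaced by the tower). PER PAIR. [cite: Sprung2012, Thm. 7.16, Prop. 7.19 and Main Conj. 7.21 (pp. 1504–1505)]
[cite: Sprung2024, Lemmas 5.5–5.9 (pp. 40–41)] [cite: Mazur1978, Cor. 4.1] [cite: Miller2011LMS, Def. 1.1] -/
theorem X8.bsdp_iff_span_eq_span_chromaticL_of_analyticRank_eq_zero_of_tower
    (h3 : realPeriodRat_eq_unit_mul_plusPeriod_three)
    (hGZK : rank_eq_analyticRank_of_analyticRank_le_one) (hmod : hasEntireLFunction_rat)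
    (hX : ClassX8 W p) (htower : ∀ n : ℕ, W.HasSurjectiveModNGaloisRep (p ^ n : ℕ))
    (h0 : W.analyticRank = 0)
    {N : ℕ} [NeZero N] {f : CuspForm (Gamma0 N) 2} (hf : IsNewformOf W f)
    {Lsharp Lflat : IwasawaAlgebra p} (hSP : IsSprungPair f p (W.frobeniusTrace p) Lsharp Lflat)
    (c : Chroma) (ξ : IwasawaAlgebra p) (hK : (⟨ξ, 0, 0⟩ : SignedDatum W p).EulerCharacteristic)
    (hKato : (∀ n : ℕ, W.HasSurjectiveModNGaloisRep (p ^ n : ℕ)) → ξ ∣ chromaticL c Lsharp Lflat) :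
    BSDp W p ↔ Ideal.span ({ξ} : Set (IwasawaAlgebra p)) = Ideal.span {chromaticL c Lsharp Lflat} := by
  have hL : W.entireLFunction 1 ≠ 0 := (W.analyticRank_eq_zero_iff_holds (hmod W)).1 h0
  have hirr : W.HasIrreducibleModPGaloisRep p := ClassX8.irr' W p hX
  have hc := ClassX8.not_dvd_chromaticConst' W p hX c
  obtain ⟨hp3, hss, -⟩ := hX
  subst hp3
  have hgood : W.HasGoodReductionAtPrime 3 := hss.1
  exact Summit.BirchSwinnertonDyer.Rank1Residual.Supersingular.bsdp_iff_span_eq_span_chromaticL_of_analyticRank_eq_zero W 3 hGZK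
    (by decide) hgood hirr hL hf (h3 W hgood hirr f hf) hSP c hc ξ hK (hKato htower)

/-- **X8 ∧ `r_an = 0` ∧ surj(3) ∧ (ram@3): `BSD(E,3) ⟺ (ξ•) = (L•_3(E))` — NO Lemma-20 binder.**
PER PAIR. [cite: Sprung2012, Thm. 7.16, Prop. 7.19 and Main Conj. 7.21 (pp. 1504–1505)]
[cite: Sprung2024, Lemmas 5.5–5.9 (pp. 40–41)] [cite: SerreAbelianLadic1968, Ch. IV §3.4 and A.1.2] -/
theorem X8.bsdp_iff_span_eq_span_chromaticL_of_analyticRank_eq_zero_of_ram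
    (h3 : realPeriodRat_eq_unit_mul_plusPeriod_three)
    (hGZK : rank_eq_analyticRank_of_analyticRank_le_one) (hmod : hasEntireLFunction_rat)
    (hX : ClassX8 W p) (hs : Surj W p) (hram : Ram W p) (h0 : W.analyticRank = 0)
    {N : ℕ} [NeZero N] {f : CuspForm (Gamma0 N) 2} (hf : IsNewformOf W f)
    {Lsharp Lflat : IwasawaAlgebra p} (hSP : IsSprungPair f p (W.frobeniusTrace p) Lsharp Lflat)
    (c : Chroma) (ξ : IwasawaAlgebra p) (hK : (⟨ξ, 0, 0⟩ : SignedDatum W p).EulerCharacteristic)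
    (hKato : (∀ n : ℕ, W.HasSurjectiveModNGaloisRep (p ^ n : ℕ)) → ξ ∣ chromaticL c Lsharp Lflat) :
    BSDp W p ↔ Ideal.span ({ξ} : Set (IwasawaAlgebra p)) = Ideal.span {chromaticL c Lsharp Lflat} :=
  X8.bsdp_iff_span_eq_span_chromaticL_of_analyticRank_eq_zero_of_tower W p h3 hGZK hmod hX
    (ClassX8.towerSurj_of_surj_of_ram W p hX hs hram) h0 hf hSP c ξ hK hKato

/-- **X8 ∩ {sst} ∧ `r_an = 0` ∧ (ram@3): `BSD(E,3) ⟺ (ξ•) = (L•_3(E))` — surj(3) automatic, NO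
Lemma-20 binder.** For semistable X8, (ram@3) reads: some multiplicative `ℓ` with `3 ∤ ord_ℓ(Δ_min)`.
PER PAIR. [cite: Serre1972, §5.4 Prop. 21 i)] [cite: Sprung2012, Thm. 7.16 and Main Conj. 7.21 (pp. 1504–1505)]
[cite: Sprung2024, Lemmas 5.5–5.9 (pp. 40–41)] -/
theorem X8.bsdp_iff_span_eq_span_chromaticL_of_semistable_of_analyticRank_eq_zero_of_ram
    (h3 : realPeriodRat_eq_unit_mul_plusPeriod_three)
    (hGZK : rank_eq_analyticRank_of_analyticRank_le_one) (hmod : hasEntireLFunction_rat)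
    (hX : ClassX8 W p) (hsst : Semistable W) (hram : Ram W p) (h0 : W.analyticRank = 0)
    {N : ℕ} [NeZero N] {f : CuspForm (Gamma0 N) 2} (hf : IsNewformOf W f)
    {Lsharp Lflat : IwasawaAlgebra p} (hSP : IsSprungPair f p (W.frobeniusTrace p) Lsharp Lflat)
    (c : Chroma) (ξ : IwasawaAlgebra p) (hK : (⟨ξ, 0, 0⟩ : SignedDatum W p).EulerCharacteristic)
    (hKato : (∀ n : ℕ, W.HasSurjectiveModNGaloisRep (p ^ n : ℕ)) → ξ ∣ chromaticL c Lsharp Lflat) :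
    BSDp W p ↔ Ideal.span ({ξ} : Set (IwasawaAlgebra p)) = Ideal.span {chromaticL c Lsharp Lflat} :=
  X8.bsdp_iff_span_eq_span_chromaticL_of_analyticRank_eq_zero_of_tower W p h3 hGZK hmod hX
    (ClassX8.towerSurj_of_semistable_of_ram W p hX hsst hram) h0 hf hSP c ξ hK hKato

end RankZero

end Summit.BirchSwinnertonDyer.Rank1Residual.Supersingular

end
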